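import Mathlib
import Summits.NavierStokesRegularity.NavierStokesRegularity.Theorems.TypeIQuarterGateScarEnvelopeTypeISatelliteTowerGalleryNormalForm

/-!
# Saturated root descent out of a gallery minimiser (the tight rate is a gallery invariant)

Rung (L10) `SaturatedDescent` of the crux idea `Cruxes/ScarEnvelopeTypeI/Ideas/zoom-recurrence.md`
(ns-idea-17 g0) on the crux `TypeIQuarterGate.ScarEnvelopeTypeI` (item 23843) — nsreg-p3's
`ExactMin.saturated` (ROUND-34 N7, conditional on the OPEN (S∞) `MinSingRateAttained`) made
UNCONDITIONAL inside one gallery: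

* `rateAt_of_ae_eq_of_norm_lt_one`, `tightRate_congr_of_ae_eq_of_norm_lt_one` — local rates and the
  tight rate at points of the open unit ball are invariants of a.e.-equality on the cylinders `Q_R(0)`,
  `R < 1`, for fields continuous on the open past (`Measure.eqOn_open_of_ae_eq`);
* ★ `galleryMinimiser_rootDescends_saturated` — if `n.U` is a ROOTED A–B gallery limit of `U` whose
  root tight rate `m⋆ = tightRate n.U 0` is minimal over all scars of all A–B gallery limits of `U`
  (e.g. the minimiser of `ABTower.exists_galleryMinimiser_of_rooted`), then along EVERY root descent
  `RootDescends n n'` to an A–B object the root rate is CONSERVED, `tightRate n'.U 0 = m⋆`, and the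
  sphere satellite is saturated too, `tightRate n'.U n'.y = m⋆`.

HONEST FRAMING: normal-form tooling about hypothetical Type-I ancient objects; nothing open is proved
— 23843, (E1⁺), the self-descending residual, the class-wide (S∞), the route and Navier–Stokes
regularity are OPEN.  LEAD-lineage prover ns-sz-p1 g6; `--supports stmt-NavierStokesRegularity-23843
--as helper`.
-/

noncomputable section

-- the summit-side namespace repeats a component by design (single-conjunct summit, D-0017)
set_option linter.dupNamespace false

open MeasureTheory Set Metric Filter Topology
open scoped ENNReal

namespace Summit.NavierStokesRegularity.NavierStokesRegularity.Cruxes.ScarEnvelopeTypeI.ZoomDictionary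

section Saturation

open Literature.Analysis.FluidPDE
variable {U U₁ U₂ : ℝ → (EuclideanSpace ℝ (Fin 3)) → (EuclideanSpace ℝ (Fin 3))}
  {P : ℝ → (EuclideanSpace ℝ (Fin 3)) → ℝ}
  {H : ℝ → (EuclideanSpace ℝ (Fin 3)) → (EuclideanSpace ℝ (Fin 3)) →L[ℝ] (EuclideanSpace ℝ (Fin 3))}
  {M : ℝ}

/-- Two fields continuous on the open past and a.e. equal on every `Q_R(0)`, `R < 1`, agree
POINTWISE on every such cylinder. -/
theorem eqOn_cylinder_of_ae_eq (h₁ : ContinuousOn (Function.uncurry U₁) (Iio 0 ×ˢ univ))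
    (h₂ : ContinuousOn (Function.uncurry U₂) (Iio 0 ×ˢ univ))
    (hae : ∀ R ∈ Ioo (0 : ℝ) 1,
      ∀ᵐ z ∂(volume.restrict (parabolicCylinder R (0 : ℝ × (EuclideanSpace ℝ (Fin 3))))), U₁ z.1 z.2 = U₂ z.1 z.2)
    {R : ℝ} (hR : R ∈ Ioo (0 : ℝ) 1) :
    EqOn (Function.uncurry U₁) (Function.uncurry U₂) (parabolicCylinder R (0 : ℝ × (EuclideanSpace ℝ (Fin 3)))) := by
  have hsub : parabolicCylinder R (0 : ℝ × (EuclideanSpace ℝ (Fin 3))) ⊆ Iio (0 : ℝ) ×ˢ (univ : Set (EuclideanSpace ℝ (Fin 3))) :=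
    parabolicCylinder_origin_subset_slab R
  exact Measure.eqOn_open_of_ae_eq ((hae R hR).mono fun z hz => hz) (isOpen_parabolicCylinder R _)
    (h₁.mono hsub) (h₂.mono hsub)

/-- **Local rates are invariants of a.e.-equality on `Q_R(0)`, `R < 1`** (points of the open unit
ball, fields continuous on the open past). -/
theorem rateAt_of_ae_eq_of_norm_lt_one (h₁ : ContinuousOn (Function.uncurry U₁) (Iio 0 ×ˢ univ))
    (h₂ : ContinuousOn (Function.uncurry U₂) (Iio 0 ×ˢ univ))
    (hae : ∀ R ∈ Ioo (0 : ℝ) 1,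
      ∀ᵐ z ∂(volume.restrict (parabolicCylinder R (0 : ℝ × (EuclideanSpace ℝ (Fin 3))))), U₁ z.1 z.2 = U₂ z.1 z.2)
    {y : (EuclideanSpace ℝ (Fin 3))} (hy : ‖y‖ < 1) {m : ℝ} (hm : RateAt m U₁ y) : RateAt m U₂ y := by
  obtain ⟨δ, hδ, hr⟩ := hm
  set R : ℝ := (1 + ‖y‖) / 2 with hRdef
  have hR : R ∈ Ioo (0 : ℝ) 1 := ⟨by positivity, by rw [hRdef]; linarith⟩
  set δ' : ℝ := min δ ((1 - ‖y‖) / 2) with hδ'def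
  have hδ' : 0 < δ' := lt_min hδ (by linarith)
  have hδ'δ : δ' ≤ δ := min_le_left _ _
  have hδ'y : δ' ≤ (1 - ‖y‖) / 2 := min_le_right _ _
  have heq := eqOn_cylinder_of_ae_eq h₁ h₂ hae hR
  refine ⟨δ', hδ', fun t ht x hx => ?_⟩
  have hmem : ((t, x) : ℝ × (EuclideanSpace ℝ (Fin 3))) ∈ parabolicCylinder R (0 : ℝ × (EuclideanSpace ℝ (Fin 3))) := by
    rw [mem_parabolicCylinder]
    simp only [Prod.fst_zero, Prod.snd_zero, zero_sub, dist_zero_right]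
    have hxy : ‖x - y‖ < δ' := by rwa [mem_ball, dist_eq_norm] at hx
    refine ⟨⟨?_, ht.2⟩, ?_⟩
    · have h1 : δ' ^ 2 ≤ R ^ 2 := by
        apply pow_le_pow_left₀ hδ'.le
        rw [hRdef]; linarith [norm_nonneg y]
      linarith [ht.1]
    · calc ‖x‖ = ‖(x - y) + y‖ := by rw [sub_add_cancel]
        _ ≤ ‖x - y‖ + ‖y‖ := norm_add_le _ _
        _ < δ' + ‖y‖ := by linarith
        _ ≤ R := by rw [hRdef]; linarith
  have he : U₂ t x = U₁ t x := (heq hmem).symm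
  rw [he]
  exact hr t ⟨lt_of_le_of_lt (by nlinarith [hδ'δ, hδ'.le]) ht.1, ht.2⟩ x
    (ball_subset_ball hδ'δ hx)

/-- **The tight rate at a point of the open unit ball is an invariant of a.e.-equality on `Q_R(0)`,
`R < 1`** (fields continuous on the open past). -/
theorem tightRate_congr_of_ae_eq_of_norm_lt_one (h₁ : ContinuousOn (Function.uncurry U₁) (Iio 0 ×ˢ univ))
    (h₂ : ContinuousOn (Function.uncurry U₂) (Iio 0 ×ˢ univ))
    (hae : ∀ R ∈ Ioo (0 : ℝ) 1,
      ∀ᵐ z ∂(volume.restrict (parabolicCylinder R (0 : ℝ × (EuclideanSpace ℝ (Fin 3))))), U₁ z.1 z.2 = U₂ z.1 z.2)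
    {y : (EuclideanSpace ℝ (Fin 3))} (hy : ‖y‖ < 1) : tightRate U₁ y = tightRate U₂ y := by
  have hae' : ∀ R ∈ Ioo (0 : ℝ) 1,
      ∀ᵐ z ∂(volume.restrict (parabolicCylinder R (0 : ℝ × (EuclideanSpace ℝ (Fin 3))))), U₂ z.1 z.2 = U₁ z.1 z.2 :=
    fun R hR => (hae R hR).mono fun z hz => hz.symm
  unfold tightRate
  congr 1
  ext m
  exact ⟨rateAt_of_ae_eq_of_norm_lt_one h₁ h₂ hae hy, rateAt_of_ae_eq_of_norm_lt_one h₂ h₁ hae' hy⟩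

/-- ★ **SATURATED ROOT DESCENT OUT OF A GALLERY MINIMISER** (p3's `ExactMin.saturated`, gallery-wise and
unconditional).  Let `n.U` be a ROOTED A–B gallery limit of `U` whose root tight rate
`m⋆ := tightRate n.U 0` is minimal over all scars of all A–B gallery limits of `U`.  Then along every
root descent `RootDescends n n'` to an A–B object of rate `M`: `tightRate n'.U 0 = m⋆` and
`tightRate n'.U n'.y = m⋆` (the sphere satellite is saturated too). -/
theorem galleryMinimiser_rootDescends_saturated (hU : ABTower M U P H) {n n' : TNode}
    (hn : ABTower M n.U n.P n.H) (h0 : ¬ RegPt n.U 0) (hg : IsGalleryLimit U n.U)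
    (hmin : ∀ (W₂ : ℝ → (EuclideanSpace ℝ (Fin 3)) → (EuclideanSpace ℝ (Fin 3))) (P₂ : ℝ → (EuclideanSpace ℝ (Fin 3)) → ℝ)
      (H₂ : ℝ → (EuclideanSpace ℝ (Fin 3)) → (EuclideanSpace ℝ (Fin 3)) →L[ℝ] (EuclideanSpace ℝ (Fin 3)))
      (y₂ : (EuclideanSpace ℝ (Fin 3))),
      ABTower M W₂ P₂ H₂ → IsGalleryLimit U W₂ → ¬ RegPt W₂ y₂ → tightRate n.U 0 ≤ tightRate W₂ y₂)
    (hd : RootDescends n n') (hn' : ABTower M n'.U n'.P n'.H) :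
    tightRate n'.U 0 = tightRate n.U 0 ∧ tightRate n'.U n'.y = tightRate n.U 0 := by
  have hUmeas : ∀ R : ℝ, 0 < R → AEStronglyMeasurable (Function.uncurry U)
      (volume.restrict (parabolicCylinder R (0 : ℝ × (EuclideanSpace ℝ (Fin 3))))) :=
    fun R hR => hU.aestronglyMeasurable_uncurry hR
  obtain ⟨L, Ū, hŪ, hae, hy4, hysat⟩ := hd
  have hy1 : ‖n'.y‖ < 1 := by rw [hy4]; norm_num
  obtain ⟨hLpos, hL0, pbar, hTR⟩ := hŪ
  -- the root ω-limit `W₁` of `n.U` along a subsequence of `L`: a gallery limit of `U`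
  obtain ⟨W₁, P₁, H₁, σ, hσ, hW₁, -, hω₁, hconv₁⟩ := hn.exists_isRootOmegaLimit hLpos hL0
  have hgW₁ : IsGalleryLimit U W₁ := hg.trans hUmeas hω₁.isGalleryLimit
  have haeŪ : ∀ R ∈ Ioo (0 : ℝ) 1,
      ∀ᵐ w ∂(volume.restrict (parabolicCylinder R (0 : ℝ × (EuclideanSpace ℝ (Fin 3))))),
        Ū w.1 w.2 = W₁ w.1 w.2 := by
    intro R hR
    obtain ⟨-, hŪmem, hconvŪ, -⟩ := hTR R hR
    have hmeasv : ∀ j, AEStronglyMeasurable (Function.uncurry (zoom n.U 0 0 (L (σ j))))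
        (volume.restrict (parabolicCylinder R (0 : ℝ × (EuclideanSpace ℝ (Fin 3))))) := fun j =>
      aestronglyMeasurable_zoom_of_inBall hn.2.1 0 (hLpos _) hR.1
    have h := ae_eq_of_tendsto_eLpNorm_three hmeasv hŪmem.1 (hω₁.1 R hR.1).1
      (hconvŪ.comp hσ.tendsto_atTop) (hconv₁ R hR.1)
    exact h.mono fun w hw => hw
  -- `n'.U = W₁` a.e. on every `Q_R(0)`, `R < 1`
  have hae' : ∀ R ∈ Ioo (0 : ℝ) 1,
      ∀ᵐ w ∂(volume.restrict (parabolicCylinder R (0 : ℝ × (EuclideanSpace ℝ (Fin 3))))),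
        n'.U w.1 w.2 = W₁ w.1 w.2 := by
    intro R hR
    filter_upwards [hae R hR, haeŪ R hR] with w h1 h2
    rw [← h1, h2]
  have hc' : ContinuousOn (Function.uncurry n'.U) (Iio 0 ×ˢ univ) := (towerObj_of_abTower hn').2.1
  have hc₁ : ContinuousOn (Function.uncurry W₁) (Iio 0 ×ˢ univ) := (towerObj_of_abTower hW₁).2.1
  -- the scars of `n'.U` at `0` and at `n'.y` are scars of `W₁`
  have hŪ' : TangentU n.U n.P 0 0 L Ū := ⟨hLpos, hL0, pbar, hTR⟩
  have hŪ0 : ¬ RegPt Ū 0 := (towerObj_of_abTower hn).not_regPt_tangentU_zero h0 hŪ'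
  have hn'0 : ¬ RegPt n'.U 0 := fun hr =>
    hŪ0 ((regPt_iff_of_ae_eq_of_norm_lt_one hae (by simp)).2 hr)
  have hW₁0 : ¬ RegPt W₁ 0 := fun hr =>
    hn'0 ((regPt_iff_of_ae_eq_of_norm_lt_one hae' (by simp)).2 hr)
  have hW₁y : ¬ RegPt W₁ n'.y := fun hr =>
    hysat.2 ((regPt_iff_of_ae_eq_of_norm_lt_one hae' hy1).2 hr)
  -- tight rates: equal for `n'.U` and `W₁`; bounded below by minimality, above by transport
  have ht0 : tightRate n'.U 0 = tightRate W₁ 0 :=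
    tightRate_congr_of_ae_eq_of_norm_lt_one hc' hc₁ hae' (by simp)
  have hty : tightRate n'.U n'.y = tightRate W₁ n'.y :=
    tightRate_congr_of_ae_eq_of_norm_lt_one hc' hc₁ hae' hy1
  have hd' : RootDescends n n' := ⟨L, Ū, hŪ', hae, hy4, hysat⟩
  have hup0 : tightRate n'.U 0 ≤ tightRate n.U 0 := hd'.tightRate_le hn hn' (by simp)
  have hupy : tightRate n'.U n'.y ≤ tightRate n.U 0 := hd'.tightRate_le hn hn' hy1
  have hlo0 : tightRate n.U 0 ≤ tightRate W₁ 0 := hmin W₁ P₁ H₁ 0 hW₁ hgW₁ hW₁0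
  have hloy : tightRate n.U 0 ≤ tightRate W₁ n'.y := hmin W₁ P₁ H₁ n'.y hW₁ hgW₁ hW₁y
  exact ⟨le_antisymm hup0 (by rw [ht0]; exact hlo0), le_antisymm hupy (by rw [hty]; exact hloy)⟩

end Saturation

end Summit.NavierStokesRegularity.NavierStokesRegularity.Cruxes.ScarEnvelopeTypeI.ZoomDictionary
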